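import Summits.NavierStokesRegularity.NavierStokesRegularity.Theorems.ScenarioCensusRowF1ax
import Summits.NavierStokesRegularity.NavierStokesRegularity.Theorems.TypeICertificateLadderRungZero
import Literature.Analysis.FluidPDE.BarkerPrange2020VorticityAlignmentTypeIHolds
import Literature.Analysis.FluidPDE.TypeIAncientMildTimeAnalytic
import HarnessLib
import Summits.NavierStokesRegularity.NavierStokesRegularity.Theorems.ScenarioCensusRowF1OneLevelTopZoom

/-!
# Census row F1, LERAY'S SNAPSHOT — criteria read at ONE INSTANT (cells F1cs / F1ce / F1rs; floors SF / RF) — LINE «snapshot-top» port, part 1/4: §1 objects (top — LINE 34's `topSet` BY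
# NAME, dimensionless Type-I constant — LINE 35's `HasTypeIConstant` BY NAME, Leray's snapshot level `snapLevel`, calm pockets at one instant, the rows `Row_F1cs` / `Row_F1ce`);
# §2 COMPACTNESS of `𝒦_M` (values and gradients) and the socket lemma

Re-homed for the scenario census (typer seat ns-census-typer-1 g9; the cells F1cs / F1ce / F1rs and the floors are members of row F1 «DECIDED IN KERNEL IN FILES» (item 75; ref
ns-census-ref g13 PRE-CHECK ✓ §18.16; critic PASS; lead label); this port makes them TREE-decided): VERBATIM PORT of ns-idea-3 LINE «snapshot-top»,
`pub/ideators/ns-idea-3/lines/snapshot-top/line-snapshot-top.lean` sha16 5c984c2d30725568 (996 l., lean check rc 0, 0 sorry), split for the 400-line rule into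
`ScenarioCensusRowF1SnapshotTop` (§1–§2) → `…SnapshotTopZoom` (§3–§4) → `…SnapshotTopRows` (§5) → `…SnapshotTopRigid` (§6–§7 + census KEYS).  Lean text VERBATIM in namespace
`…Theorems.ScenarioCensus.SnapshotTop` (the line's `…Cruxes.ScenarioCensusRowF1.SnapshotTopLine` re-homed); port edits: LINE 34's `topSet` (+ lemmas) and LINE 35's
`HasTypeIConstant` (+ lemmas), restated VERBATIM by the line, are taken BY NAME from the landed two-time-top / one-level-top ports; the second proof term `rowF1po_holds` is
not re-declared; `@[conjecture]` on the residual `SnapshotCollapse` (≡ `ScenarioCensus.Row_F1`, OPEN); ten one-line docstrings added (gate lint).  Statements untouched.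

No census VALUE is moved here (row F1 stays OPEN-WITH-LINE; the members become TREE-decided by name); NS regularity is NOT proved; `Row_F1` is untouched (zero
movement, `snapshotCollapse_iff_rowF1`); no summit statement is proved by this file.
-/

-- the summit and its single problem share the name `NavierStokesRegularity` (D-0017 nested layout)
set_option linter.dupNamespace false

noncomputable section

open MeasureTheory Set Function Filter TopologicalSpace Metric
open scoped Topology NNReal ENNReal

namespace Summit.NavierStokesRegularity.NavierStokesRegularity.Theorems.ScenarioCensus.SnapshotTop

open Literature.Analysis Literature.Analysis.FluidPDE
open Summit.NavierStokesRegularity.NavierStokesRegularity.Theorems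
open Summit.NavierStokesRegularity.NavierStokesRegularity.Theses

/-- `ℝ³`. -/
abbrev E3 := EuclideanSpace ℝ (Fin 3)

/-! ## §1 Objects: top, dimensionless Type-I constant, Leray's SNAPSHOT level `c_S`, calm pockets at ONE instant; the rows -/

/-- **Leray's SNAPSHOT level `c_S`** — half the universal constant of Leray's EVERY-TIME lower rate `‖u(t)‖_∞ ≥ c√ν/√(T − t)`,
`t ∈ [0, T)`, at a maximal Clay solution (tree `leray_blowup_rate_top_holds`, Leray 1934 §19 (3.9); `exists_fast_at` below extracts a
`c_S`-fast POINT at EVERY instant).  LINE 35 only had the EVENTUAL form (`typeICertificateLadder_rungZero`: fast points at SOME times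
near `T`), which is why every earlier row of this seat needed its hypothesis at ALL late times. -/
def snapLevel : ℝ := Classical.choose leray_blowup_rate_top_holds / 2

/-- Leray's snapshot level is positive. -/
theorem snapLevel_pos : 0 < snapLevel :=
  div_pos (Classical.choose_spec leray_blowup_rate_top_holds).1 two_pos

/-- **Calm pockets at ONE instant `t`** (level `Λ`, reach `A`, radius `a`, calm threshold `ε`; everything in the parabolic unit
`√(ν(T − t))` and the Type-I speed unit `√ν/√(T − t)`): every `Λ`-fast point has, within distance `A√(ν(T−t))`, the centre of a
closed ball of radius `a√(ν(T−t))` on which the DIMENSIONLESS speed is `≤ ε` — a pocket of fluid that is calm AT THE CRITICAL SCALE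
(it may still move at Type-I speed `ε√ν/√(T−t)`; compare the SUBCRITICAL pores `|u| ≤ Λ(t)`, `Λ(t)√(T−t) → 0`, of this seat's earlier
row `Row_F1po`, copied in §5).  A condition on the single snapshot `u(t, ·)`. -/
def CalmPocketsAt (ν T : ℝ) (u : ℝ → E3 → E3) (Λ A a ε t : ℝ) : Prop :=
  ∀ x ∈ TwoTimeTop.topSet ν T u Λ t, ∃ z : E3, ‖z - x‖ ≤ A * Real.sqrt (ν * (T - t)) ∧
    ∀ x' : E3, ‖x' - z‖ ≤ a * Real.sqrt (ν * (T - t)) → Real.sqrt (T - t) * ‖u t x'‖ ≤ ε * Real.sqrt ν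

/-- **ROW F1cs «CALM-POCKET SNAPSHOTS»** (Type I · no symmetry · Clay class; PROVED, `rowF1cs_holds`): for every dimensionless Type-I
constant `M`, reach `A` and radius `a > 0` there is `ε = ε(M, A, a) > 0` such that: if at SOME sequence of instants `t_k ↑ T` (an
`∃ᶠ`-hypothesis — snapshots only, no time window) every `c_S`-fast point has an `ε`-calm pocket of radius `a√(ν(T−t_k))` within
`A√(ν(T−t_k))`, the solution extends smoothly past `T`. -/
def Row_F1cs : Prop :=
  ∀ (M A a : ℝ), 0 < a → ∃ ε : ℝ, 0 < ε ∧
    ∀ (ν T : ℝ), 0 < ν → 0 < T → ∀ (u : ℝ → E3 → E3) (p : ℝ → E3 → ℝ),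
    IsClassicalNSSolutionOn (Ico 0 T) ν 0 u p → IsLerayHopfOn T ν 0 (u 0) u →
    HasRapidSpatialDecay (u 0) → OneLevelTop.HasTypeIConstant ν T M u →
    (∃ᶠ t in 𝓝[<] T, CalmPocketsAt ν T u snapLevel A a ε t) →
    HasSmoothExtensionPast ν 0 u T

/-- **ROW F1ce «CALM POCKETS, EVENTUALLY»** (the `∀ᶠ`-form; a formal COROLLARY of `Row_F1cs`, `rowF1ce_of_rowF1cs`; recorded to
exhibit the quantifier gain). -/
def Row_F1ce : Prop :=
  ∀ (M A a : ℝ), 0 < a → ∃ ε : ℝ, 0 < ε ∧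
    ∀ (ν T : ℝ), 0 < ν → 0 < T → ∀ (u : ℝ → E3 → E3) (p : ℝ → E3 → ℝ),
    IsClassicalNSSolutionOn (Ico 0 T) ν 0 u p → IsLerayHopfOn T ν 0 (u 0) u →
    HasRapidSpatialDecay (u 0) → OneLevelTop.HasTypeIConstant ν T M u →
    (∀ᶠ t in 𝓝[<] T, CalmPocketsAt ν T u snapLevel A a ε t) →
    HasSmoothExtensionPast ν 0 u T

/-- Order: the calm-snapshot row implies its `ε`-form. -/
theorem rowF1ce_of_rowF1cs (h : Row_F1cs) : Row_F1ce := by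
  intro M A a ha
  obtain ⟨ε, hε, hrow⟩ := h M A a ha
  exact ⟨ε, hε, fun ν T hν hT u p hsol hLH hdec hM hev => hrow ν T hν hT u p hsol hLH hdec hM hev.frequently⟩

/-! ## §2 COMPACTNESS of `𝒦_M` (values AND gradients) and the SOCKET LEMMA (LINE 35 §2, with the gradient clause added)

`𝒦_M` = `IsTypeIAncientMild M`.  The tree's extraction theorem `exists_tendsto_of_typeI_seq_Ioo` (KNSS 2009, Lemma 6.1) fed with
MEMBERS of `𝒦_M` is the sequential compactness of `𝒦_M` under pointwise convergence of values and of spatial gradients on the open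
past.  (LINE 35 recorded the value clause only; the slice kills of §4/§6 read values resp. gradients on ONE slice.) -/

/-- **Compactness of `𝒦_M`** (pointwise values and gradients). -/
theorem limitClass_compact (M : ℝ) (Wn : ℕ → ℝ → E3 → E3) (h : ∀ n, IsTypeIAncientMild M (Wn n)) :
    ∃ φ : ℕ → ℕ, StrictMono φ ∧ ∃ W : ℝ → E3 → E3, IsTypeIAncientMild M W ∧
      (∀ t < 0, ∀ y : E3, Tendsto (fun j => Wn (φ j) t y) atTop (𝓝 (W t y))) ∧
      (∀ t < 0, ∀ y : E3, Tendsto (fun j => fderiv ℝ (Wn (φ j) t) y) atTop (𝓝 (fderiv ℝ (W t) y))) := by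
  set A : ℕ → ℝ := fun n => -((n : ℝ) + 1) with hA
  have hAlim : Tendsto A atTop atBot := by
    have h1 : Tendsto (fun n : ℕ => (n : ℝ) + 1) atTop atTop :=
      tendsto_atTop_add_const_right _ _ tendsto_natCast_atTop_atTop
    exact tendsto_neg_atTop_atBot.comp h1
  have hsub : ∀ n, Ioo (A n) 0 ×ˢ (univ : Set E3) ⊆ Iio 0 ×ˢ univ := fun n =>
    prod_mono (fun t ht => ht.2) subset_rfl
  have hc : ∀ n, ContinuousOn (uncurry (Wn n)) (Ioo (A n) 0 ×ˢ univ) := fun n =>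
    (h n).continuousOn_uncurry.mono (hsub n)
  have hdiv : ∀ n, ∀ t ∈ Ioo (A n) 0, IsWeaklyDivFree (Wn n t) := fun n t ht =>
    (h n).isWeaklyDivFree ht.2
  have hmild : ∀ n, ∀ s t : ℝ, A n < s → s < t → t < 0 → ∀ x,
      Wn n t x = UnboundedOperators.heatExtension (Wn n s) (t - s) x -
        oseenDuhamel 1 s (Wn n) (Wn n) t x :=
    fun n s t _ hst ht x => (h n).mild_eq_heatExtension hst ht x
  have hI : ∀ n, ∀ t ∈ Ioo (A n) 0, ∀ x, ‖Wn n t x‖ ≤ M / Real.sqrt (-t) := fun n t ht x =>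
    (h n).norm_le ht.2 x
  obtain ⟨φ, hφ, W, hW, hpt, hgrad, -, -⟩ := exists_tendsto_of_typeI_seq_Ioo M hAlim hc hdiv hmild hI
  exact ⟨φ, hφ, W, hW, hpt, hgrad⟩

/-- **SOCKET LEMMA (the compactness upgrade; LINE 35, gradient clause added).**  Let `P Λ W` be any «defect of `W` below `Λ`»
predicate.  Suppose the LIMIT KILL: whenever members `W_n ∈ 𝒦_M` with `P εₙ W_n`, `εₙ → 0⁺`, converge (values and gradients,
pointwise on the open past) to `W ∈ 𝒦_M`, the limit rests at `(−1, 0)`.  Then there is ONE LEVEL `Λ₁ = Λ₁(M, κ, P) > 0` such that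
no `W ∈ 𝒦_M` with `‖W(−1, 0)‖ ≥ κ` has defect below `Λ₁`.  (Contradiction + compactness; `Λ₁` is ineffective.) -/
theorem exists_level_of_limitKill (M : ℝ) {κ : ℝ} (hκ : 0 < κ) (P : ℝ → (ℝ → E3 → E3) → Prop)
    (hkill : ∀ (Wn : ℕ → ℝ → E3 → E3) (W : ℝ → E3 → E3) (ε : ℕ → ℝ),
      (∀ n, 0 < ε n) → Tendsto ε atTop (𝓝 0) → (∀ n, IsTypeIAncientMild M (Wn n)) → IsTypeIAncientMild M W →
      (∀ n, P (ε n) (Wn n)) → (∀ t < 0, ∀ y : E3, Tendsto (fun n => Wn n t y) atTop (𝓝 (W t y))) →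
      (∀ t < 0, ∀ y : E3, Tendsto (fun n => fderiv ℝ (Wn n t) y) atTop (𝓝 (fderiv ℝ (W t) y))) →
      W (-1) 0 = 0) :
    ∃ Λ₁ : ℝ, 0 < Λ₁ ∧ ∀ W : ℝ → E3 → E3, IsTypeIAncientMild M W → κ ≤ ‖W (-1) 0‖ → ¬ P Λ₁ W := by
  by_contra hno
  have hex : ∀ n : ℕ, ∃ W : ℝ → E3 → E3,
      IsTypeIAncientMild M W ∧ κ ≤ ‖W (-1) 0‖ ∧ P (1 / ((n : ℝ) + 1)) W := by
    intro n
    by_contra hn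
    exact hno ⟨1 / ((n : ℝ) + 1), by positivity, fun W hW hκW hP => hn ⟨W, hW, hκW, hP⟩⟩
  choose Wn hWn hκn hPn using hex
  obtain ⟨φ, hφ, W, hW, hpt, hgrad⟩ := limitClass_compact M Wn hWn
  have hφt : Tendsto φ atTop atTop := hφ.tendsto_atTop
  set ε : ℕ → ℝ := fun j => 1 / ((φ j : ℝ) + 1) with hε
  have hεpos : ∀ j, 0 < ε j := fun j => by simp only [hε]; positivity
  have hεlim : Tendsto ε atTop (𝓝 0) := by
    have h1 : Tendsto (fun j => (φ j : ℝ) + 1) atTop atTop :=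
      tendsto_atTop_add_const_right _ _ (tendsto_natCast_atTop_atTop.comp hφt)
    exact tendsto_const_nhds.div_atTop h1
  have hzero : W (-1) 0 = 0 :=
    hkill (fun j => Wn (φ j)) W ε hεpos hεlim (fun j => hWn (φ j)) hW (fun j => hPn (φ j))
      (fun t ht y => hpt t ht y) (fun t ht y => hgrad t ht y)
  have hge : κ ≤ ‖W (-1) 0‖ :=
    ge_of_tendsto ((hpt (-1) (by norm_num) 0).norm) (Eventually.of_forall fun j => hκn (φ j))
  rw [hzero, norm_zero] at hge
  exact absurd hge (not_le.2 hκ)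

end Summit.NavierStokesRegularity.NavierStokesRegularity.Theorems.ScenarioCensus.SnapshotTop

end
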